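import Literature.MathematicalPhysics.QuantumFieldTheory.Balaban1983to89.B8Prop5KLevelLettersRec
import Literature.MathematicalPhysics.QuantumFieldTheory.Balaban1983to89.B8Prop5KLevelLettersG

/-!
# `Balaban1983to89.B8Prop5KLevelLettersGRec` — RECORD TWIN of `B8Prop5KLevelLettersG` §2 ([Balaban1985RegularSpaces] PROPOSITION 5 (1.107)–(1.110) p. 94 AT `k` LEVELS,
# joint J-SU: the `G`-valued bookkeeping of the Proposition-5 sockets — [Balaban1985Averaging] p. 20 «We consider a Lie subgroup G of a unitary group U(N)»; print's
# case of record `G = SU(N)`, Lie algebra `𝔤 = 𝔰𝔲(N)` (traceless Hermitian gauge parameters, (1.17) p. 78)) FOR THE SYMMETRISED CENTRED block averaging (0.4) of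
# [Balaban1987RG1]: the Landau condition and (1.29) OF RECORD (`IsLandau138WZ`, `QTZ`, `Restr129Z`)

statement-level skeleton of published theorems with citation tags; proofs where landed; nothing here is a claim about the Yang–Mills mass gap

T. Bałaban, *Spaces of regular gauge field configurations on a lattice and gauge fixing conditions*, Commun. Math. Phys. **99** (1985) 75–102 `[Balaban1985RegularSpaces]`
("[6]"): Prop. 5 (1.106)–(1.110) pp. 93–94, (1.86)–(1.88) p. 91, (1.38) p. 82, (1.29) p. 81, Thm 4 p. 88, (1.17) p. 78; T. Bałaban, *Averaging operations for lattice gauge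
theories*, Commun. Math. Phys. **98** (1985) 17–51 `[Balaban1985Averaging]` ("[3]"): p. 20; T. Bałaban, *Renormalization group approach to lattice gauge field theories. I*,
Commun. Math. Phys. **109** (1987) 249–301 `[Balaban1987RG1]` ("[I]"): (0.3)–(0.4) pp. 252–253.  STATUS: published, refereed.

CITATION HEADER (lean-in-tree rule).  Cell `pub-ymgap`, «N05-REC» R8 = the `G`∕τ-EDITION OF RECORD (desk `R6-PLAN.md` §6 (B)), file T6 — LEAD PEN dag-n05-e g40.  WHAT IS
REPRODUCED = ✓`B8Prop5KLevelLettersG` §2 (this seat g33, engine) VERBATIM under the record token map of `B8Prop5KLevelLettersRec` (`IsLandau138W ∕ QT ∕ Restr129 ↦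
IsLandau138WZ ∕ QTZ ∕ Restr129Z`, `isLandau138W_gaugeFixed_of_multiplier ↦ B8Prop5KLevelLettersRec.isLandau138WZ_gaugeFixed_of_multiplier`, `isLandau138W_congr ↦
B8Eq138LandauZdRec.isLandau138WZ_congr`): ★ `hP5_step_of_HFP_mem`, ★ `hP5_of_HFP_mem`, ★ `hP5base_of_HFP_mem` — the Proposition-5 sockets of the `G`-valued RECORD driver
(`B8Thm4KLevelGammaGRec.thm4_exists_all_levels_supp_landau138_γ_mem`) from the plain-currency fixed point carrying `∀ x, e^{iλ(x)} ∈ G`.  §1 of the engine file (`mem_of_mgauge_eq`,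
`norm_exp_I_smul_sub_one_le_eighth_of_le_twelfth`, `apply_eq_zero_of_cfgExp_mem_of_le_twelfth`) is structure-free and consumed BY NAME from `B8Prop5KLevelLettersG`.  THEOREM
NAMES = the engine's (namespace `…GRec`).  Kind «kernel-checked proof», theorems only: no `def`, no `… : Prop` fact, no `instance`, no `notation`, no existing module modified.
`--supports stmt-QuantumFields-20541` (K0⁷-keyed, COUNT-NEUTRAL).

HONEST SCOPE.  Bookkeeping only: no analytic content; Proposition 5's fixed point itself is the record `SockHFP` providers' business; the record crown stays CONDITIONAL ×2 on
the named Cov facts; `HThm4Rec` UNDISCHARGED; N05 ∕ N07 NOT discharged; one finite `𝕋⁴` programme at fixed `ε`, Bałaban AS PRINTED; nothing continuum ∕ ℝ⁴ ∕ OS ∕ mass-gap ∕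
Clay.  No `sorry`, no `def`.
-/

noncomputable section

open NormedSpace
open Complex (I I_ne_zero)

namespace Literature.MathematicalPhysics.QuantumFieldTheory.Balaban1983to89.B8Prop5KLevelLettersGRec

open MatrixLog B7Prop1Explicit B7Prop2Explicit B7Eq92Concrete
open B7Eq78Linearization (conjR)
open B8Ineq132 (covDerivFwd covDeriv BondTouches)
open B8Eq182Proof (gAd)
open B8Eq184Proof (gaugeExp cfgExp)
open B8Eq188Proof (frakF3)
open B8Eq138LandauZd (covDivB covLap logCfg)
open B8Eq138LandauZdRec (QTZ IsLandau138Z IsLandau138WZ isLandau138WZ_congr)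
open B8Eq140Level (SideTouches)
open B8Eq119TwistedAxialRec (Restr129Z)
open B8Prop3GaugeFixedKLevel (eq_mgauge_inv_of_mgauge_eq)
open B8Thm4TruncationLocal (base_datum)
open B8Prop5KLevelLettersRec (isLandau138WZ_gaugeFixed_of_multiplier)

-- `Site` alone could resolve to the torus sites of `Setup.lean`; re-export the `ℤ^d` sites of `B7Prop1Explicit`.
export B7Prop1Explicit (Site)

variable {d : ℕ}

/-! ## §1  The `G`-bridges OF RECORD: Proposition 5's sockets of the `G`-valued record driver from the plain-currency fixed point with `e^{iλ} ∈ G` -/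

section Assembly

/-- p. 77's «at least one end-point» side condition implies the plaquette-side condition, `d ≥ 2` (private device, as in `B8Prop5KLevelLetters`).
[cite: Balaban1985RegularSpaces, p.77 (convention before (1.5))] -/
private theorem sideTouches_of_bondTouches₂ (hd2 : 2 ≤ d) {S : Set (Site d)} {y : Site d} {τ : Fin d}
    (hb : BondTouches S y τ) : SideTouches S y τ := by
  haveI : Nontrivial (Fin d) := Fin.nontrivial_iff_two_le.mpr hd2
  obtain ⟨κ, hκ⟩ := exists_ne τ
  exact B8Eq140Level.sideTouches_of_bondTouches hκ hb

variable {𝔹 : Type*} [CStarAlgebra 𝔹] [Nontrivial 𝔹]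

/-- **The Prop.-5 step in plain currency ⇒ the socket `hP5 m` of the `G`-VALUED Theorem-4 driver** (`B8Thm4SupportLocalBdryG` ∕ `B8Thm4InductionLocalG`):
`B8Prop5KLevelLetters.hP5_step_of_HFP` VERBATIM except that the displayed fixed point `λ` carries ONE more clause — `e^{iλ(x)} ∈ G` at every site (for
`G = SU(N)`: `λ` Hermitian AND TRACE-FREE, `B8SpecialUnitaryTrace.gaugeExp_mem_specialUnitaryUnits`; print p. 76 «G = SU(N)») — and the gauge transformation
`v := e^{iλ}` is returned `G`-VALUED instead of merely unitary.  Everything else (support, (1.108), the Landau condition of record for `U₁^{v⁻¹}`, (1.29) for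
`u₁·v`) byte-identical. [cite: Balaban1985RegularSpaces, Prop. 5 pp.93–94, (1.107)–(1.110) p.94, (1.86)–(1.88) p.91, (1.38) p.82, p.76] -/
theorem hP5_step_of_HFP_mem (hd2 : 2 ≤ d) {η : ℝ} (hη : 0 < η) (L m : ℕ) {G : Subgroup 𝔹ˣ} {U₀ : Site d → Fin d → 𝔹ˣ}
    (hU₀ : ∀ x κ, U₀ x κ ∈ unitaryUnits 𝔹) {cstar α₄ : ℝ} (hs₁ : α₄ ≤ 1 / 84) (hcs : cstar ≤ 1 / 12)
    (Ω : ℕ → Set (Site d)) (Λs : ℕ → ℕ → Set (Site d)) (u₁ : Site d → 𝔹ˣ) (U₁ : Site d → Fin d → 𝔹ˣ) (A : Site d → Fin d → 𝔹)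
    (hdat : ∀ j, j ≤ m → ∀ b ∈ {b : Site d × Fin d | SideTouches (Ω j) b.1 b.2},
      U₁ b.1 b.2 = cfgExp η A b.1 b.2 ∧ IsSelfAdjoint (A b.1 b.2) ∧ ‖A b.1 b.2‖ ≤ cstar * ((L : ℝ) ^ j * η)⁻¹)
    (hFP : ∃ lam : Site d → 𝔹, (∀ x, IsSelfAdjoint (lam x)) ∧ (∀ x, x ∉ Ω 0 → lam x = 0) ∧ (∀ x, gaugeExp lam x ∈ G) ∧
      (∀ j, j ≤ m + 1 → ∀ b ∈ {b : Site d × Fin d | SideTouches (Ω j) b.1 b.2},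
        ‖lam b.1‖ ≤ α₄ ∧ ((L : ℝ) ^ j * η) * ‖covDerivFwd η U₀ b.2 lam b.1‖ ≤ α₄) ∧
      (∃ μ : ℕ → Site d → 𝔹, ∀ x ∈ Ω 0,
        covLap η U₀ ((Ω 0).indicator fun y => covDivB η U₀ A y + covLap η U₀ lam y +
          ((conjR (gaugeExp lam y)⁻¹ (covDivB η U₀ A y) - covDivB η U₀ A y) +
            (gAd (covLap η U₀ lam y) (lam y) - covLap η U₀ lam y) + ∑ μ, frakF3 η U₀ lam A y μ)) x =
          QTZ L (m + 1) (Λs (m + 1)) U₀ μ x) ∧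
      Restr129Z L (m + 1) (Λs (m + 1)) U₀ (u₁ * gaugeExp lam)) :
    ∃ (v : Site d → 𝔹ˣ) (lam : Site d → 𝔹), (∀ x, v x ∈ G) ∧ (∀ x, x ∉ Ω 0 → v x = 1) ∧
      (∀ j, j ≤ m + 1 → ∀ b ∈ {b : Site d × Fin d | SideTouches (Ω j) b.1 b.2}, (v b.1 : 𝔹) = ((gaugeExp lam b.1 : 𝔹ˣ) : 𝔹) ∧
        (v (b.1 + e b.2) : 𝔹) = ((gaugeExp lam (b.1 + e b.2) : 𝔹ˣ) : 𝔹)) ∧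
      (∀ j, j ≤ m + 1 → ∀ b ∈ {b : Site d × Fin d | SideTouches (Ω j) b.1 b.2},
        ‖lam b.1‖ ≤ α₄ ∧ ((L : ℝ) ^ j * η) * ‖covDerivFwd η U₀ b.2 lam b.1‖ ≤ α₄) ∧
      IsLandau138WZ L (m + 1) η (Ω 0) (Λs (m + 1)) U₀ (mgauge U₀ v⁻¹ U₁) ∧ Restr129Z L (m + 1) (Λs (m + 1)) U₀ (u₁ * v) := by
  obtain ⟨lam, hsa, hoff, hlamG, h108, hmult, h129⟩ := hFP
  have hE0 : ∀ {y : Site d} {τ : Fin d}, BondTouches (Ω 0) y τ → (y, τ) ∈ {b : Site d × Fin d | SideTouches (Ω 0) b.1 b.2} :=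
    fun hb => sideTouches_of_bondTouches₂ hd2 hb
  have hα12 : α₄ ≤ 1 / 12 := hs₁.trans (by norm_num)
  have hα70 : α₄ ≤ 1 / 70 := hs₁.trans (by norm_num)
  have hd1 : 0 < d := by omega
  -- (1.108) at level `j = 0` on the bonds touching `Ω₀`
  have h0 : ∀ y τ, BondTouches (Ω 0) y τ → ‖lam y‖ ≤ α₄ ∧ η * ‖covDerivFwd η U₀ τ lam y‖ ≤ α₄ := fun y τ hb => by
    simpa only [pow_zero, one_mul] using h108 0 (Nat.zero_le _) (y, τ) (hE0 hb)
  have hl : ∀ x ∈ Ω 0, ‖lam x‖ ≤ 1 / 12 := fun x hx => (h0 x ⟨0, hd1⟩ (Or.inl hx)).1.trans hα12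
  have hD : ∀ x ∈ Ω 0, ∀ μ, η * ‖covDerivFwd η U₀ μ lam x‖ ≤ 1 / 70 := fun x hx μ => (h0 x μ (Or.inl hx)).2.trans hα70
  have hback : ∀ x ∈ Ω 0, ∀ μ : Fin d, BondTouches (Ω 0) (x - e μ) μ := fun x hx μ => Or.inr (by rwa [sub_add_cancel])
  have ha : ∀ x ∈ Ω 0, ∀ μ, η * ‖covDeriv η U₀ μ lam x‖ ≤ 1 / 70 := fun x hx μ => by
    rw [B8Eq151V2Divergence.norm_covDeriv_eq (unitaryUnits_le_U1 (hU₀ _ _)) lam]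
    exact (h0 _ μ (hback x hx μ)).2.trans hα70
  have hY : ∀ x ∈ Ω 0, ∀ μ, η * ‖conjR (U₀ (x - e μ) μ)⁻¹ (A (x - e μ) μ)‖ ≤ 1 / 12 := fun x hx μ => by
    obtain ⟨-, -, hA⟩ := hdat 0 (Nat.zero_le _) (x - e μ, μ) (hE0 (hback x hx μ))
    rw [B8Ineq132.norm_conjR ((U1 𝔹).inv_mem (unitaryUnits_le_U1 (hU₀ _ _)))]
    rw [pow_zero, one_mul] at hA
    calc η * ‖A (x - e μ) μ‖ ≤ η * (cstar * η⁻¹) := mul_le_mul_of_nonneg_left hA hη.le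
      _ = cstar := by rw [mul_left_comm, mul_inv_cancel₀ hη.ne', mul_one]
      _ ≤ 1 / 12 := hcs
  have hLan : IsLandau138WZ L (m + 1) η (Ω 0) (Λs (m + 1)) U₀ (mgauge U₀ (gaugeExp lam)⁻¹ (cfgExp η A)) :=
    isLandau138WZ_gaugeFixed_of_multiplier hη L (m + 1) (Ω 0) (Λs (m + 1)) U₀ A hl hD ha hY hmult
  have hcongr : ∀ (x : Site d) (μ : Fin d), BondTouches (Ω 0) x μ →
      mgauge U₀ (gaugeExp lam)⁻¹ U₁ x μ = mgauge U₀ (gaugeExp lam)⁻¹ (cfgExp η A) x μ := fun x μ hb => by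
    rw [mgauge_apply, mgauge_apply, (hdat 0 (Nat.zero_le _) (x, μ) (hE0 hb)).1]
  refine ⟨gaugeExp lam, lam, hlamG, fun x hx => ?_, fun j _ b _ => ⟨rfl, rfl⟩, h108,
    (isLandau138WZ_congr hcongr).mpr hLan, h129⟩
  · exact Units.ext (by rw [gaugeExp, hoff x hx, smul_zero, val_expUnit, NormedSpace.exp_zero, Units.val_one])


/-- **The socket `hP5` of the `G`-valued driver (`thm4_exists_all_levels_supp_landau138_γ_mem`), verbatim, from the fixed point in plain currency with the
`G`-clause `e^{iλ} ∈ G` at every level `1 ≤ m < k`** — `B8Prop5KLevelLetters.hP5_of_HFP` VERBATIM except: the level datum's `u₁` is `G`-valued (as the `G`-driver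
hands it over), the fixed point carries `∀ x, e^{iλ(x)} ∈ G`, and `v` is returned `G`-valued. [cite: Balaban1985RegularSpaces, Prop. 5 pp.93–94, (1.106)–(1.110) p.94, Thm 4 p.88, p.76] -/
theorem hP5_of_HFP_mem (hd2 : 2 ≤ d) {η : ℝ} (hη : 0 < η) (L k : ℕ) {G : Subgroup 𝔹ˣ} {U₀ U' : Site d → Fin d → 𝔹ˣ}
    (hU₀ : ∀ x κ, U₀ x κ ∈ unitaryUnits 𝔹) {cstar α₄ : ℝ} (hs₁ : α₄ ≤ 1 / 84) (hcs : cstar ≤ 1 / 12)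
    (Ω : ℕ → Set (Site d)) (Λs : ℕ → ℕ → Set (Site d))
    (HFP : ∀ m, 1 ≤ m → m < k → ∀ (u₁ : Site d → 𝔹ˣ) (U₁ : Site d → Fin d → 𝔹ˣ) (A : Site d → Fin d → 𝔹),
      (∀ x, u₁ x ∈ G) → (∀ x, x ∉ Ω 0 → u₁ x = 1) → mgauge U₀ u₁ U₁ = U' → Restr129Z L m (Λs m) U₀ u₁ →
      IsLandau138WZ L m η (Ω 0) (Λs m) U₀ U₁ →
      (∀ j, j ≤ m → ∀ b ∈ {b : Site d × Fin d | SideTouches (Ω j) b.1 b.2},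
        U₁ b.1 b.2 = cfgExp η A b.1 b.2 ∧ IsSelfAdjoint (A b.1 b.2) ∧ ‖A b.1 b.2‖ ≤ cstar * ((L : ℝ) ^ j * η)⁻¹) →
      ∃ lam : Site d → 𝔹, (∀ x, IsSelfAdjoint (lam x)) ∧ (∀ x, x ∉ Ω 0 → lam x = 0) ∧ (∀ x, gaugeExp lam x ∈ G) ∧
        (∀ j, j ≤ m + 1 → ∀ b ∈ {b : Site d × Fin d | SideTouches (Ω j) b.1 b.2},
          ‖lam b.1‖ ≤ α₄ ∧ ((L : ℝ) ^ j * η) * ‖covDerivFwd η U₀ b.2 lam b.1‖ ≤ α₄) ∧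
        (∃ μ : ℕ → Site d → 𝔹, ∀ x ∈ Ω 0,
          covLap η U₀ ((Ω 0).indicator fun y => covDivB η U₀ A y + covLap η U₀ lam y +
            ((conjR (gaugeExp lam y)⁻¹ (covDivB η U₀ A y) - covDivB η U₀ A y) +
              (gAd (covLap η U₀ lam y) (lam y) - covLap η U₀ lam y) + ∑ μ, frakF3 η U₀ lam A y μ)) x =
            QTZ L (m + 1) (Λs (m + 1)) U₀ μ x) ∧
        Restr129Z L (m + 1) (Λs (m + 1)) U₀ (u₁ * gaugeExp lam)) :
    ∀ m, 1 ≤ m → m < k → ∀ (u₁ : Site d → 𝔹ˣ) (U₁ : Site d → Fin d → 𝔹ˣ) (A : Site d → Fin d → 𝔹),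
      (∀ x, u₁ x ∈ G) → (∀ x, x ∉ Ω 0 → u₁ x = 1) → mgauge U₀ u₁ U₁ = U' → Restr129Z L m (Λs m) U₀ u₁ →
      IsLandau138WZ L m η (Ω 0) (Λs m) U₀ U₁ →
      (∀ j, j ≤ m → ∀ b ∈ {b : Site d × Fin d | SideTouches (Ω j) b.1 b.2},
        U₁ b.1 b.2 = cfgExp η A b.1 b.2 ∧ IsSelfAdjoint (A b.1 b.2) ∧ ‖A b.1 b.2‖ ≤ cstar * ((L : ℝ) ^ j * η)⁻¹) →
      ∃ (v : Site d → 𝔹ˣ) (lam : Site d → 𝔹), (∀ x, v x ∈ G) ∧ (∀ x, x ∉ Ω 0 → v x = 1) ∧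
        (∀ j, j ≤ m + 1 → ∀ b ∈ {b : Site d × Fin d | SideTouches (Ω j) b.1 b.2}, (v b.1 : 𝔹) = ((gaugeExp lam b.1 : 𝔹ˣ) : 𝔹) ∧
          (v (b.1 + e b.2) : 𝔹) = ((gaugeExp lam (b.1 + e b.2) : 𝔹ˣ) : 𝔹)) ∧
        (∀ j, j ≤ m + 1 → ∀ b ∈ {b : Site d × Fin d | SideTouches (Ω j) b.1 b.2},
          ‖lam b.1‖ ≤ α₄ ∧ ((L : ℝ) ^ j * η) * ‖covDerivFwd η U₀ b.2 lam b.1‖ ≤ α₄) ∧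
        IsLandau138WZ L (m + 1) η (Ω 0) (Λs (m + 1)) U₀ (mgauge U₀ v⁻¹ U₁) ∧ Restr129Z L (m + 1) (Λs (m + 1)) U₀ (u₁ * v) :=
  fun m hm hmk u₁ U₁ A hu₁ hsupp hfix h129 hLan hdat =>
    hP5_step_of_HFP_mem hd2 hη L m hU₀ hs₁ hcs Ω Λs u₁ U₁ A hdat (HFP m hm hmk u₁ U₁ A hu₁ hsupp hfix h129 hLan hdat)

/-- **The socket `hP5base` of the `G`-valued driver, verbatim** (the first step `u₁ = 1`, `U₁ = U′`): `B8Prop5KLevelLetters.hP5base_of_HFP` VERBATIM except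
that the plain-currency fixed point `HFP₀` carries `∀ x, e^{iλ(x)} ∈ G` and `v` is returned `G`-valued.  The level-0 datum `A₀ := (iη)⁻¹ log U′` is built exactly as
there (`B8Thm4TruncationLocal.base_datum`, `|U′ − 1| ≤ a ≤ 1/4`). [cite: Balaban1985RegularSpaces, Prop. 5 pp.93–94, (1.66) p.88, (1.106)–(1.110) p.94, p.76] -/
theorem hP5base_of_HFP_mem (hd2 : 2 ≤ d) {η : ℝ} (hη : 0 < η) (L : ℕ) {G : Subgroup 𝔹ˣ} {U₀ U' : Site d → Fin d → 𝔹ˣ}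
    (hU₀ : ∀ x κ, U₀ x κ ∈ unitaryUnits 𝔹) (hU' : ∀ x κ, U' x κ ∈ unitaryUnits 𝔹) {cstar α₄ a : ℝ} (hs₁ : α₄ ≤ 1 / 84)
    (hcs : cstar ≤ 1 / 12) (ha : a ≤ 1 / 4) (ha2 : 2 * a ≤ cstar) (Ω : ℕ → Set (Site d)) (Λs : ℕ → ℕ → Set (Site d))
    (h66 : ∀ b ∈ {b : Site d × Fin d | SideTouches (Ω 0) b.1 b.2}, ‖((U' b.1 b.2 : 𝔹ˣ) : 𝔹) - 1‖ ≤ a)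
    (HFP₀ : ∀ A : Site d → Fin d → 𝔹,
      (∀ j, j ≤ 0 → ∀ b ∈ {b : Site d × Fin d | SideTouches (Ω j) b.1 b.2},
        U' b.1 b.2 = cfgExp η A b.1 b.2 ∧ IsSelfAdjoint (A b.1 b.2) ∧ ‖A b.1 b.2‖ ≤ cstar * ((L : ℝ) ^ j * η)⁻¹) →
      ∃ lam : Site d → 𝔹, (∀ x, IsSelfAdjoint (lam x)) ∧ (∀ x, x ∉ Ω 0 → lam x = 0) ∧ (∀ x, gaugeExp lam x ∈ G) ∧
        (∀ j, j ≤ 1 → ∀ b ∈ {b : Site d × Fin d | SideTouches (Ω j) b.1 b.2},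
          ‖lam b.1‖ ≤ α₄ ∧ ((L : ℝ) ^ j * η) * ‖covDerivFwd η U₀ b.2 lam b.1‖ ≤ α₄) ∧
        (∃ μ : ℕ → Site d → 𝔹, ∀ x ∈ Ω 0,
          covLap η U₀ ((Ω 0).indicator fun y => covDivB η U₀ A y + covLap η U₀ lam y +
            ((conjR (gaugeExp lam y)⁻¹ (covDivB η U₀ A y) - covDivB η U₀ A y) +
              (gAd (covLap η U₀ lam y) (lam y) - covLap η U₀ lam y) + ∑ μ, frakF3 η U₀ lam A y μ)) x =
            QTZ L 1 (Λs 1) U₀ μ x) ∧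
        Restr129Z L 1 (Λs 1) U₀ ((1 : Site d → 𝔹ˣ) * gaugeExp lam)) :
    ∃ (v : Site d → 𝔹ˣ) (lam : Site d → 𝔹), (∀ x, v x ∈ G) ∧ (∀ x, x ∉ Ω 0 → v x = 1) ∧
      (∀ j, j ≤ 1 → ∀ b ∈ {b : Site d × Fin d | SideTouches (Ω j) b.1 b.2}, (v b.1 : 𝔹) = ((gaugeExp lam b.1 : 𝔹ˣ) : 𝔹) ∧
        (v (b.1 + e b.2) : 𝔹) = ((gaugeExp lam (b.1 + e b.2) : 𝔹ˣ) : 𝔹)) ∧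
      (∀ j, j ≤ 1 → ∀ b ∈ {b : Site d × Fin d | SideTouches (Ω j) b.1 b.2},
        ‖lam b.1‖ ≤ α₄ ∧ ((L : ℝ) ^ j * η) * ‖covDerivFwd η U₀ b.2 lam b.1‖ ≤ α₄) ∧
      IsLandau138WZ L 1 η (Ω 0) (Λs 1) U₀ (mgauge U₀ v⁻¹ U') ∧ Restr129Z L 1 (Λs 1) U₀ ((1 : Site d → 𝔹ˣ) * v) := by
  set A₀ : Site d → Fin d → 𝔹 := fun y μ => η⁻¹ • ((I⁻¹ : ℂ) • mlog ((U' y μ : 𝔹ˣ) : 𝔹))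
  have hdat : ∀ j, j ≤ 0 → ∀ b ∈ {b : Site d × Fin d | SideTouches (Ω j) b.1 b.2},
      U' b.1 b.2 = cfgExp η A₀ b.1 b.2 ∧ IsSelfAdjoint (A₀ b.1 b.2) ∧ ‖A₀ b.1 b.2‖ ≤ cstar * ((L : ℝ) ^ j * η)⁻¹ := by
    intro j hj b hb
    obtain rfl : j = 0 := Nat.le_zero.mp hj
    obtain ⟨-, hexp, hsa, hn⟩ := base_datum hη U₀ U' hU' ha b.1 b.2 (h66 b hb)
    refine ⟨hexp, hsa, hn.trans ?_⟩
    rw [pow_zero, one_mul]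
    exact mul_le_mul_of_nonneg_right ha2 (inv_nonneg.mpr hη.le)
  exact hP5_step_of_HFP_mem hd2 hη L 0 hU₀ hs₁ hcs Ω Λs 1 U' A₀ hdat (HFP₀ A₀ hdat)

end Assembly


#print axioms hP5_step_of_HFP_mem
#print axioms hP5_of_HFP_mem
#print axioms hP5base_of_HFP_mem

end Literature.MathematicalPhysics.QuantumFieldTheory.Balaban1983to89.B8Prop5KLevelLettersGRec

end
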